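import Mathlib
import Literature.Geometry.Lorentzian.KerrConvergence
import Literature.Geometry.Lorentzian.KerrSchild
import Literature.Geometry.Lorentzian.BoostedKerrBandAnchoredPaths
import HarnessLib

/-!
# BandAnchoredPaths — MOVED (deprecated alias module)

Topic `Literature/Uncategorized`. The named fact formerly parked here by the gate,
`Literature.Uncategorized.BandAnchoredPaths` (anchored paths in the radial band of a boosted Kerr
background; accept-time relocation of a proposition written inline in a
`Summits/FinalStateConjecture/FinalStateConjecture/Theorems/` proposal, human ruling 2026-08-15), now
lives — statement byte-identical — at `Literature.Geometry.Lorentzian.BandAnchoredPaths`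
(`Literature/Geometry/Lorentzian/BoostedKerrBandAnchoredPaths.lean`, librarian move, refactor item
wi-39009, 2026-08-17). This module keeps only a deprecated reducible `abbrev` under the old name, so
that the one file still naming `Literature.Uncategorized.BandAnchoredPaths`
(`Summits/FinalStateConjecture/FinalStateConjecture/Theorems/StarvedNecksNeckGapDecayStubBandAnchoredPaths.lean`)
keeps compiling (deprecation warning only). The original imports are kept so that nothing downstream
loses a transitive import. Provers: import the new module and use the new name.
-/

namespace Literature.Uncategorized

/-- DEPRECATED parking name of `Literature.Geometry.Lorentzian.BandAnchoredPaths` (moved, statement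
byte-identical). [folklore] -/
@[deprecated Literature.Geometry.Lorentzian.BandAnchoredPaths (since := "2026-08-17")]
abbrev BandAnchoredPaths : Prop := Literature.Geometry.Lorentzian.BandAnchoredPaths

end Literature.Uncategorized
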